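import Summits.QuantumAdvantage.QuantumAdvantage.Theses.AnfPresentation
import Summits.QuantumAdvantage.QuantumAdvantage.Theorems.HintDialAnfLadder
import Literature.Computability.Complexity.SymmetricCircuit

/-!
# PebbleDial (tree twin, `Theorems/PebbleDial.lean`; byte-identical to the node `g14/PebbleDial.lean` but for the namespace) — cell `decomp-qadv`, lens-3 («one certified translation + split beneath»), generation 14

NODE on the parent route `route-QuantumAdvantage-AnfPresentation` (target item `AnfResidual`, stmt-27982,
`X := SignedExactCubicSliceANF ∉ PromiseBPP'`; refines its residual `LiftA`, stmt-27984).

THE NEW AXIS.  Every previous rung of the cell restricts the classical decider by a SYNTACTIC circuit budget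
(`AC⁰`, `AC⁰[⊕]`, read-pattern, degree).  This node restricts it by SYMMETRY, importing finite model theory
(Anderson–Dawar symmetric circuits ⟷ fixed-point logic with counting; Cai–Fürer–Immerman / bijective pebble
games) through an explicit dictionary:

* an ANF instance `(F, G)` (two cubic coefficient tables over `𝔽₂` on the variable set `[n]`) ↦ the finite
  relational structure `𝔄(F,G) = ([n]; F.cube, G.cube ; F.const, G.const)` (two ternary relations, two
  Boolean constants); its input bits are indexed by `AnfIdx n = Bool × Option ([n]³)` (`§1`);
* relabelling the variables by `σ ∈ S_n` ↦ the diagonal action `permIdx σ` on `AnfIdx n`; the forrelation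
  value — hence the SIGN asked by the promise problem — is an ISOMORPHISM-INVARIANT query of `𝔄(F,G)`
  (`value_permPair`, `§1`);
* a classical decider ↦ a family `C n : Circuit (AnfIdx n)` of THRESHOLD circuits that is SYMMETRIC: every
  `permIdx σ` extends to an automorphism of `C n` (tree `Circuit.IsVarSymmetric`, Dawar–Wilsenach Def. 3.7 /
  Anderson–Dawar Def. 7); such a family decides an isomorphism-invariant class (`accepts_permPair`, `§2`);
* `SymTC` := the languages whose restriction to instance codes is decided by a polynomial-size symmetric
  threshold family (`§2`).

PIECES (`§3`), TARGET `X = AnfResidual` (27982):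
* `SymRung`  — `SignedExactCubicSliceANF ∉ promiseLift (SymTC ∩ P)`: no polynomial-time algorithm whose every
  slice is a symmetric threshold circuit decides the sign.  WEAKER (`symRung_of_anfResidual`: `PromiseP ⊆
  PromiseBPP'`); INCOMPARABLE with the blocker `RungA` (27983: `AC⁰[⊕] ∩ P`): symmetric threshold circuits
  contain MAJORITY (`∉ AC⁰[⊕]`) and do not contain Gaussian elimination over `𝔽₂` (Atserias–Bulatov–Dawar 2009),
  which `AC⁰[⊕]`… does not contain either, but `P` does — the two class dials cut `P` along different grains.
* `SymLift` — `RungA → SymRung → X`, the declared RESIDUAL (bare conditional; strictly below `LiftA`).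
* exact split `anfResidual_iff : X ↔ RungA ∧ SymRung ∧ SymLift`, `liftA_iff : LiftA ↔ (RungA → SymRung) ∧ SymLift`,
  and `closes … : QuantumAdvantage` BY NAME through `AnfPresentation.closes`.

THE ONE CERTIFIED TRANSLATION (`§3`, the lens's single EQUIV): `symRung_iff` / `symRungNU_iff` — the rung,
stated over `promiseLift`, is EQUIVALENT to «no polynomial-size symmetric threshold family (with a `P` language
agreeing with it on codes) answers the sign on every even-arity exact instance» — i.e. to a statement in the
native currency of symmetric-circuit lower bounds.

THE LINE BENEATH (`§4`, typed, T-free where it matters): the bijective `k`-pebble game on ANF structures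
(`CkEquivANF`, Hella's game for the vocabulary above), FOOLING PAIRS (`FoolingPairs k`: opposite-sign exact
pairs of unbounded arity that Duplicator cannot tell apart with `k` pebbles — a purely combinatorial statement
about cubic forms), the SUPPORT HYPOTHESIS (`SupportTheoremANF`: Anderson–Dawar's support theorem read in this
vocabulary — polynomial-size symmetric threshold families are `≡_{C^k}`-invariant for some `k`), and the proved
implication `symRungNU_of_foolingPairs : SupportTheoremANF → (∀ k, FoolingPairs k) → SymRungNU` (`→ SymRung`).

THE QUADRATIC FILTER (`§5`, the node's (D)-analysis, typed): on the QUADRATIC exact sub-slice exactness forces the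
polar matrix to be NONSINGULAR and the sign to be the bit `G.const ⊕ Arf(F)`; the Arf invariant of a nonsingular
form is FPC-definable (inverse over `𝔽₂` + determinant over `ℤ` mod 8, both FPC-definable: Holm 2012 slide p.7),
so by print facts the quadratic grade is symmetric-EASY (`QuadSymEasy`, prediction) and the proved
`quadratic_filter : QuadSymEasy → SupportTheoremANF → (large-k fooling pairs are never quadratic)` says the
symmetric dial is NOT short-circuited by linear algebra (contrast: g13's `AC⁰[⊕]` dial, whose `T`-free core IS
linear algebra): its content is properly cubic, where the target's is.  The opposite branch is typed too
(`quadratic_absorption`).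

THE SIGN LAW (`§6`, PROVED, degree-free): for every exact pair the sign is `+1` iff `G.const = domBit F`, the
DOMINANT VALUE of `F` (`const_eq_domBit_of_value_eq_one`, `const_ne_domBit_of_value_eq_neg_one`, from the tree's
duality theorem read at `y = 0`); for nonsingular quadratic `F` the dominant value is the Arf invariant, so the
prediction `QuadSymEasy` REDUCES to the single FMT fact `ArfSym` («a `P`-uniform symmetric threshold family computes
the Arf invariant of a nonsingular quadratic form»): `quadSymEasy_of_arfSym`, `quadratic_filter_of_arfSym`; and
fooling pairs become concrete: `foolingPairs_iff_domBit` (hide the dominant value of a certified-bent cubic form from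
the `k`-pebble game).

WHY NOVEL (relative to the cell and the literature searched): no route, node or card of the summit restricts the
classical side by circuit SYMMETRY in the Anderson–Dawar sense (the closed card `symmetry-is-free` concerns
QUANTUM deciders and randomised classical ones with LOCAL coins, where Eickmeyer–Grohe symmetrisation makes the
restriction vacuous; `SymTC` is deterministic / coin-free, i.e. the bounded-counting-width regime, where symmetric
lower bounds are unconditional theorems), and no paper found joins Forrelation / `BQP` vs `BPP` to FPC / CFI.
WHY EACH PIECE IS STRICTLY WEAKER: `SymRung` because `promiseLift (SymTC ∩ P) ⊆ PromiseP ⊆ PromiseBPP'` and the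
converse would need `BPP`-hardness from a symmetric-class lower bound (must-FAIL probes in the bc7 file); `SymLift`
because it is `LiftA` with one more hypothesis (`liftA_iff`).

No `sorry`, no new axioms; every `def … : Prop` is tagged in its docstring.
-/

set_option linter.dupNamespace false

namespace Summit.QuantumAdvantage.QuantumAdvantage.Theorems.PebbleDial

open Finset
open Literature.Computability.Complexity
open Literature.Computability.QuantumComplexity
open Summit.QuantumAdvantage.QuantumAdvantage.Theses.AnfPresentation
  (AnfResidual RungA LiftA NearExactIsExact SignedExactSliceIsLift AnfEquiv RungANonuniform)
open Summit.QuantumAdvantage.QuantumAdvantage.Theorems.HintDial (eval_bit bit_injective rungA_of_anfResidual)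
open CubicForm (bit)

variable {n : ℕ}

/-! ## §1 The dictionary: ANF instances as finite structures, relabelling invariance of the sign -/

/-- [dictionary] Input positions of an ANF instance on `n` variables: `(b, none)` is the constant bit of form
`b` (`false` = `F`, `true` = `G`), `(b, some (i,j,l))` the cube coefficient `(i,j,l)` of form `b`. -/
abbrev AnfIdx (n : ℕ) : Type := Bool × Option (Fin n × Fin n × Fin n)

/-- [dictionary] The input word of the structure `𝔄(F,G)`: the bit sitting at each position. -/
def bitsFG (F G : CubicForm n) : AnfIdx n → Bool
  | (false, none) => F.const
  | (true, none) => G.const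
  | (false, some (i, j, l)) => F.cube i j l
  | (true, some (i, j, l)) => G.cube i j l

/-- [dictionary] The input word of an instance. -/
def bits (I : CubicANFPair) : AnfIdx I.n → Bool := bitsFG I.F I.G

/-- [dictionary] The diagonal action of a variable relabelling `σ ∈ S_n` on input positions
(`(b, (i,j,l)) ↦ (b, (σ i, σ j, σ l))`, constants fixed) — the action of `Sym([n])` on the atoms of `𝔄(F,G)`. -/
def permIdx (σ : Equiv.Perm (Fin n)) : Equiv.Perm (AnfIdx n) :=
  Equiv.prodCongr (Equiv.refl Bool) (Equiv.optionCongr (Equiv.prodCongr σ (Equiv.prodCongr σ σ)))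

/-- PebbleDialA helper `permIdx_none` (decomp-qadv land package; see the module docstring). -/
@[simp] theorem permIdx_none (σ : Equiv.Perm (Fin n)) (b : Bool) : permIdx σ (b, none) = (b, none) := rfl

/-- PebbleDialA helper `permIdx_some` (decomp-qadv land package; see the module docstring). -/
@[simp] theorem permIdx_some (σ : Equiv.Perm (Fin n)) (b : Bool) (i j l : Fin n) :
    permIdx σ (b, some (i, j, l)) = (b, some (σ i, σ j, σ l)) := rfl

/-- [dictionary] The symmetry group of the node: all diagonal relabellings. -/
def diag (n : ℕ) : Set (Equiv.Perm (AnfIdx n)) := Set.range (permIdx (n := n))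

/-- PebbleDialA helper `permIdx_mem_diag` (decomp-qadv land package; see the module docstring). -/
theorem permIdx_mem_diag (σ : Equiv.Perm (Fin n)) : permIdx σ ∈ diag n := ⟨σ, rfl⟩

/-- [dictionary] Relabelling the variables of a cubic table: `(σ·F).cube i j l = F.cube (σ i) (σ j) (σ l)`. -/
def permForm (σ : Equiv.Perm (Fin n)) (F : CubicForm n) : CubicForm n :=
  ⟨F.const, fun i j l => F.cube (σ i) (σ j) (σ l)⟩

/-- [dictionary] Relabelling an instance (an isomorphic copy of `𝔄(F,G)`). -/
def permPair (I : CubicANFPair) (σ : Equiv.Perm (Fin I.n)) : CubicANFPair :=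
  ⟨I.n, permForm σ I.F, permForm σ I.G⟩

/-- The input word of the relabelled instance is the old word read through `permIdx σ`. -/
theorem bitsFG_permForm (σ : Equiv.Perm (Fin n)) (F G : CubicForm n) :
    bitsFG (permForm σ F) (permForm σ G) = fun a => bitsFG F G (permIdx σ a) := by
  funext a
  rcases a with ⟨b, _ | ⟨i, j, l⟩⟩ <;> cases b <;> rfl

/-- PebbleDialA helper `bits_permPair` (decomp-qadv land package; see the module docstring). -/
theorem bits_permPair (I : CubicANFPair) (σ : Equiv.Perm (Fin I.n)) :
    bits (permPair I σ) = fun a => bits I (permIdx σ a) :=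
  bitsFG_permForm σ I.F I.G

/-- [dictionary] The induced permutation of the Boolean cube `{0,1}ⁿ`: `x ↦ x ∘ σ`. -/
def shuffle (σ : Equiv.Perm (Fin n)) : Equiv.Perm (Fin n → Bool) where
  toFun x := fun i => x (σ i)
  invFun x := fun i => x (σ.symm i)
  left_inv x := funext fun i => by simp
  right_inv x := funext fun i => by simp

/-- PebbleDialA helper `shuffle_apply` (decomp-qadv land package; see the module docstring). -/
@[simp] theorem shuffle_apply (σ : Equiv.Perm (Fin n)) (x : Fin n → Bool) (i : Fin n) :
    shuffle σ x i = x (σ i) := rfl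

/-- Triple sums are invariant under a simultaneous relabelling of the three indices. -/
theorem sum3_perm {M : Type*} [AddCommMonoid M] (σ : Equiv.Perm (Fin n)) (g : Fin n → Fin n → Fin n → M) :
    ∑ i, ∑ j, ∑ l, g (σ i) (σ j) (σ l) = ∑ i, ∑ j, ∑ l, g i j l :=
  calc ∑ i, ∑ j, ∑ l, g (σ i) (σ j) (σ l) = ∑ i, ∑ j, ∑ l, g i (σ j) (σ l) :=
        Equiv.sum_comp σ (fun i => ∑ j, ∑ l, g i (σ j) (σ l))
    _ = ∑ i, ∑ j, ∑ l, g i j l := Finset.sum_congr rfl fun i _ =>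
        (Equiv.sum_comp σ (fun j => ∑ l, g i j (σ l))).trans
          (Finset.sum_congr rfl fun j _ => Equiv.sum_comp σ (g i j))

/-- ★ [dictionary] Relabelling the table relabels the presented function: `(σ·F)(x) = F(x ∘ σ⁻¹)`. -/
theorem eval_permForm (σ : Equiv.Perm (Fin n)) (F : CubicForm n) (x : Fin n → Bool) :
    (permForm σ F).eval x = F.eval (shuffle σ.symm x) := by
  apply bit_injective
  rw [eval_bit, eval_bit]
  simp only [permForm, shuffle_apply]
  congr 1
  calc ∑ i, ∑ j, ∑ l, bit (F.cube (σ i) (σ j) (σ l)) * (bit (x i) * bit (x j) * bit (x l))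
      = ∑ i, ∑ j, ∑ l, (fun a b c => bit (F.cube a b c) *
          (bit (x (σ.symm a)) * bit (x (σ.symm b)) * bit (x (σ.symm c)))) (σ i) (σ j) (σ l) := by
        simp only [Equiv.symm_apply_apply]
    _ = _ := sum3_perm σ (fun a b c => bit (F.cube a b c) *
          (bit (x (σ.symm a)) * bit (x (σ.symm b)) * bit (x (σ.symm c))))

/-- The twist `(-1)^{x·y}` is invariant under a simultaneous relabelling of `x` and `y`. -/
theorem twist_shuffle (σ : Equiv.Perm (Fin n)) (x y : Fin n → Bool) :
    twist (shuffle σ x) (shuffle σ y) = twist x y := by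
  unfold twist
  simp only [shuffle_apply]
  exact Equiv.prod_comp σ (fun l => if (x l && y l) = true then (-1 : ℝ) else 1)

/-- ★ [dictionary] Forrelation is invariant under a simultaneous relabelling of the variables of `f` and `g`
(the inner product `x·y` is `S_n`-invariant). -/
theorem forrelation_shuffle (σ : Equiv.Perm (Fin n)) (f g : (Fin n → Bool) → Bool) :
    forrelation (fun x => f (shuffle σ x)) (fun y => g (shuffle σ y)) = forrelation f g := by
  unfold forrelation
  congr 1
  calc ∑ x, ∑ y, signOf (f (shuffle σ x)) * twist x y * signOf (g (shuffle σ y))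
      = ∑ x, ∑ y, (fun a b => signOf (f a) * twist a b * signOf (g b)) (shuffle σ x) (shuffle σ y) := by
        simp only [twist_shuffle]
    _ = ∑ x, ∑ y, (fun a b => signOf (f a) * twist a b * signOf (g b)) x (shuffle σ y) :=
        Equiv.sum_comp (shuffle σ) (fun a => ∑ y, (fun a b => signOf (f a) * twist a b * signOf (g b)) a (shuffle σ y))
    _ = ∑ x, ∑ y, signOf (f x) * twist x y * signOf (g y) :=
        Finset.sum_congr rfl fun x _ => Equiv.sum_comp (shuffle σ) (fun b => signOf (f x) * twist x b * signOf (g b))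

/-- ★★ [dictionary] THE SIGN IS AN ISOMORPHISM-INVARIANT QUERY: relabelling the variables of an instance does not
change its forrelation value (hence neither the promise `Φ = 1` / `Φ = -1` nor the arity). -/
theorem value_permPair (I : CubicANFPair) (σ : Equiv.Perm (Fin I.n)) : (permPair I σ).value = I.value := by
  show forrelation (permForm σ I.F).eval (permForm σ I.G).eval = forrelation I.F.eval I.G.eval
  rw [show (permForm σ I.F).eval = fun x => I.F.eval (shuffle σ.symm x) from funext (eval_permForm σ I.F),
    show (permForm σ I.G).eval = fun x => I.G.eval (shuffle σ.symm x) from funext (eval_permForm σ I.G)]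
  exact forrelation_shuffle σ.symm _ _

/-- PebbleDialA helper `permPair_mem_yes_iff` (decomp-qadv land package; see the module docstring). -/
theorem permPair_mem_yes_iff (I : CubicANFPair) (σ : Equiv.Perm (Fin I.n)) :
    (permPair I σ).encode ∈ SignedExactCubicSliceANF.yes ↔ I.encode ∈ SignedExactCubicSliceANF.yes := by
  rw [CubicANFPair.encode_mem_yes_iff, CubicANFPair.encode_mem_yes_iff, value_permPair]; exact Iff.rfl

/-- PebbleDialA helper `permPair_mem_no_iff` (decomp-qadv land package; see the module docstring). -/
theorem permPair_mem_no_iff (I : CubicANFPair) (σ : Equiv.Perm (Fin I.n)) :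
    (permPair I σ).encode ∈ SignedExactCubicSliceANF.no ↔ I.encode ∈ SignedExactCubicSliceANF.no := by
  rw [CubicANFPair.encode_mem_no_iff, CubicANFPair.encode_mem_no_iff, value_permPair]; exact Iff.rfl

/-! ## §2 Symmetric threshold families on ANF structures (Anderson–Dawar, Def. 7, in this vocabulary) -/

/-- [dictionary] A POLYNOMIAL-SIZE SYMMETRIC THRESHOLD FAMILY on ANF structures: one threshold-basis circuit per
arity `n`, reading the positions `AnfIdx n`, every diagonal relabelling of which extends to a circuit
automorphism (tree `Circuit.IsVarSymmetric`, Dawar–Wilsenach 2025 Def. 3.7 = Anderson–Dawar 2017 Def. 7 for the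
vocabulary `(R_F, R_G ternary; c_F, c_G)`), of size `≤ p(n)`.  Non-uniform (no uniformity condition). -/
def IsSymTCFamily (C : (n : ℕ) → Circuit (AnfIdx n)) : Prop :=
  (∀ n, (C n).IsVarSymmetric (diag n) ∧ (C n).IsOver tcBasis) ∧ ∃ p : Polynomial ℕ, ∀ n, (C n).size ≤ p.eval n

/-- [dictionary] The verdict of a family on an instance. -/
def accepts (C : (n : ℕ) → Circuit (AnfIdx n)) (I : CubicANFPair) : Bool := (C I.n).eval (bits I)


end Summit.QuantumAdvantage.QuantumAdvantage.Theorems.PebbleDial
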